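import Literature.LinearAlgebra.Matrix.MaximumDeterminantCompletionExistence
import HarnessLib

/-!
# BalabanUVNodes ∕ N15 — THE KING-MODEL RUNG (PART Ϯ-a): TRACE AND ENTRY TOOLS FOR THE VOLUME LAW — `|Re tr(PE)| ≤ β·Σ‖E_{ab}‖` from an entry bound on `P`,
# the ℓ¹ size of a perturbation supported on a set of index pairs, and the entries of a positive semidefinite matrix: from `‖A_{ab}‖² ≤ A_{aa}A_{bb}` (the `2 × 2` principal minor, tree's
# Literature `norm_apply_sq_le_of_posSemidef`) every entry is bounded by the largest diagonal entry, and the diagonal is Loewner-monotone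
# (Track A, DAG node N15 = NE2; FAN-OUT v1.1 §N15 s3 «KING-MODEL RUNG … + what the curved case adds»; count-neutral)

HONEST FRAMING.  Count-neutral (cell `pub-ymgap`, seat `pub-ymgap-dag-n15-e` g54; `--supports stmt-QuantumFields-27247 --as helper` = K3ᴬ, KEY MAP v3).  Elementary finite-matrix
facts over an `RCLike` field, stated in the shape PART Ϯ (the VOLUME LAW for King's Gaussian normalisations) consumes them.  The tree's `T4LogDetOscillation` (pub-balaban) proves the
real-symmetric volume-of-difference law `|ln det M − ln det M′| ≤ c⁻¹·Σ|M_{ij} − M′_{ij}|` from a LOEWNER FLOOR `M, M′ ≥ c·1` (its `abs_trace_mul_le`, `abs_inv_entry_le`); PART Ϯ keeps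
its SHAPE (response sandwich + trace against the perturbation) but feeds the trace with KING's DIAGONAL `G(x,x)` (Kato) instead of `1∕m²` — for that the tools must be stated over
`𝕜 ∈ {ℝ, ℂ}` with norms of entries, which is what this file does.  Nothing of Bałaban's (3.42) asserted; nothing continuum ∕ ℝ⁴ ∕ OS ∕ Clay; NOT a node discharge (N15 of record untouched).

CONTENT.  §1 ★ `abs_re_trace_mul_le_of_norm_entry_le` (`‖P_{ab}‖ ≤ β` for all `a, b` ⟹ `|Re tr(PE)| ≤ β·Σ_aΣ_b‖E_{ab}‖`), ★ `sum_norm_entry_le_of_support` (`E` vanishes off the index-pair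
set `R` and is `≤ δ` in norm on `R` ⟹ `Σ_aΣ_b‖E_{ab}‖ ≤ δ·#R`), `abs_re_trace_mul_le_of_support` (the two combined: `|Re tr(PE)| ≤ β·δ·#R`); §2 `re_diag_nonneg_of_posSemidef`,
★ `re_diag_le_of_posSemidef_sub` (LOEWNER-MONOTONE DIAGONAL: `A ≤ B` ⟹ `Re A_{aa} ≤ Re B_{aa}`), `re_diag_le_of_le_smul_one` (`A ≤ β·1` ⟹ `Re A_{aa} ≤ β`), `re_diag_mem_Icc_of_sandwich`;
§3 (the `2 × 2` principal minor `‖A_{ab}‖² ≤ Re A_{aa}·Re A_{bb}` for `A ⪰ 0` is the tree's Literature `norm_apply_sq_le_of_posSemidef` [Dym2023 Thm 38.3, Step 1] — IMPORTED, not restated;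
preflight `dedup.landed` caught my copy) ★★ **`norm_entry_le_of_re_diag_le`** (`A ⪰ 0`, `Re A_{aa} ≤ β` for all `a` ⟹ `‖A_{ab}‖ ≤ β` for all `a, b` —
THE DIAGONAL DOMINATES, the positive-semidefinite form of Ε-e `abs_lapF_inv_le_diag`), ★ `norm_entry_le_of_posSemidef_sub_of_re_diag_le` (`0 ⪯ A ⪯ B`, `Re B_{aa} ≤ β` ⟹ `‖A_{ab}‖ ≤ β` —
the form used for the FULL propagator `A₀(U)⁻¹ ⪯ M_U⁻¹` whose diagonal Kato bounds by King's `G(x,x)`).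

PRIOR TREE ART (by name, not restated): Literature `Literature.LinearAlgebra.Matrix.norm_apply_sq_le_of_posSemidef` (`MaximumDeterminantCompletionExistence`), Mathlib `Matrix.PosSemidef.diag_nonneg`,
`RCLike.abs_re_le_norm`, `RCLike.ofReal_re`; the tree's `T4LogDetOscillation.abs_trace_mul_le` ∕ `sum_abs_sub_le_of_support` (real entries, absolute values) are the `𝕜 = ℝ` shape of §1.
Dedup (rg at filing): basename 0 files; `abs_re_trace_mul_le_of_norm_entry_le|sum_norm_entry_le_of_support|norm_entry_le_of_re_diag_le|re_diag_le_of_posSemidef_sub|norm_entry_le_of_posSemidef_sub_of_re_diag_le` 0 tree files.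
Locators: [King1986] (2.13)–(2.14) p.653 (the Gaussian normalisations whose locality PART Ϯ proves), (4.4) p.670 (`G(x,x)`); [HornJohnson2013] Obs. 7.1.2 §7.1 (principal submatrices of a PSD
matrix are PSD) and 7.1.P1 (`|a_{ij}|² ≤ a_{ii}a_{jj}`) — cited as the classical statement; [Dym2023] Thm 38.3 Step 1 p.416 (the tree's minor lemma).  0 `sorry`, 0 `def`.
-/

noncomputable section

open scoped BigOperators ComplexConjugate ComplexOrder
open Finset Matrix

namespace Summit.QuantumFields.YangMills.BalabanUVNodes.N15KingModelRung.Analytic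

open Literature.LinearAlgebra.Matrix (norm_apply_sq_le_of_posSemidef)

variable {𝕜 : Type*} [RCLike 𝕜] {ι : Type*}

/-! ## §1 Traces against a perturbation with small, sparsely supported entries -/

section Trace

variable [Fintype ι]

/-- ★ `|Re tr(PE)| ≤ β·Σ_aΣ_b‖E_{ab}‖` whenever every entry of `P` has norm `≤ β` (`tr(PE) = Σ_{a,b}P_{ab}E_{ba}`). [cite: King1986, (2.13)–(2.14) p.653; HornJohnson2013, Obs. 7.1.2 §7.1] -/
theorem abs_re_trace_mul_le_of_norm_entry_le {P E : Matrix ι ι 𝕜} {β : ℝ} (hP : ∀ a b, ‖P a b‖ ≤ β) :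
    |RCLike.re (P * E).trace| ≤ β * ∑ a, ∑ b, ‖E a b‖ := by
  rw [Matrix.trace]
  simp only [Matrix.diag_apply, Matrix.mul_apply, map_sum]
  calc |∑ a, ∑ b, RCLike.re (P a b * E b a)|
      ≤ ∑ a, ∑ b, |RCLike.re (P a b * E b a)| :=
        (Finset.abs_sum_le_sum_abs _ _).trans (Finset.sum_le_sum fun a _ => Finset.abs_sum_le_sum_abs _ _)
    _ ≤ ∑ a, ∑ b, β * ‖E b a‖ := by
        refine Finset.sum_le_sum fun a _ => Finset.sum_le_sum fun b _ => ?_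
        calc |RCLike.re (P a b * E b a)| ≤ ‖P a b * E b a‖ := RCLike.abs_re_le_norm _
          _ = ‖P a b‖ * ‖E b a‖ := norm_mul _ _
          _ ≤ β * ‖E b a‖ := mul_le_mul_of_nonneg_right (hP a b) (norm_nonneg _)
    _ = β * ∑ a, ∑ b, ‖E a b‖ := by
        rw [Finset.sum_comm]
        simp only [← Finset.mul_sum]

/-- ★ THE ℓ¹ SIZE OF A SPARSE PERTURBATION: if `E_{ab} = 0` off the index-pair set `R` and `‖E_{ab}‖ ≤ δ` on `R`, then `Σ_aΣ_b‖E_{ab}‖ ≤ δ·#R`. [cite: King1986, (2.13)–(2.14) p.653] -/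
theorem sum_norm_entry_le_of_support {E : Matrix ι ι 𝕜} {R : Finset (ι × ι)} {δ : ℝ}
    (hoff : ∀ a b, (a, b) ∉ R → E a b = 0) (hon : ∀ a b, (a, b) ∈ R → ‖E a b‖ ≤ δ) :
    ∑ a, ∑ b, ‖E a b‖ ≤ δ * R.card := by
  classical
  rw [← Finset.sum_product' (f := fun a b => ‖E a b‖)]
  have hsub : ∑ p ∈ R, ‖E p.1 p.2‖ = ∑ p ∈ (Finset.univ : Finset ι) ×ˢ (Finset.univ : Finset ι), ‖E p.1 p.2‖ := by
    apply Finset.sum_subset (fun p _ => Finset.mem_product.mpr ⟨Finset.mem_univ _, Finset.mem_univ _⟩)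
    intro p _ hp
    rw [hoff p.1 p.2 hp, norm_zero]
  rw [← hsub]
  calc ∑ p ∈ R, ‖E p.1 p.2‖ ≤ ∑ _p ∈ R, δ := Finset.sum_le_sum fun p hp => hon p.1 p.2 hp
    _ = δ * R.card := by rw [Finset.sum_const, nsmul_eq_mul, mul_comm]

/-- The two combined: `|Re tr(PE)| ≤ β·δ·#R` for `‖P_{ab}‖ ≤ β` (`β ≥ 0`) and `E` supported on `R` with entries `≤ δ` there. [cite: King1986, (2.13)–(2.14) p.653] -/
theorem abs_re_trace_mul_le_of_support {P E : Matrix ι ι 𝕜} {β δ : ℝ} (hβ : 0 ≤ β) (hP : ∀ a b, ‖P a b‖ ≤ β) {R : Finset (ι × ι)}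
    (hoff : ∀ a b, (a, b) ∉ R → E a b = 0) (hon : ∀ a b, (a, b) ∈ R → ‖E a b‖ ≤ δ) :
    |RCLike.re (P * E).trace| ≤ β * (δ * R.card) :=
  (abs_re_trace_mul_le_of_norm_entry_le hP).trans (mul_le_mul_of_nonneg_left (sum_norm_entry_le_of_support hoff hon) hβ)

end Trace

/-! ## §2 The diagonal of a positive semidefinite matrix; Loewner monotonicity of the diagonal -/

section Diagonal

/-- The diagonal of a PSD matrix is (real and) nonnegative. [cite: HornJohnson2013, Obs. 7.1.2 §7.1] -/
theorem re_diag_nonneg_of_posSemidef {A : Matrix ι ι 𝕜} (hA : A.PosSemidef) (a : ι) : 0 ≤ RCLike.re (A a a) :=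
  (RCLike.nonneg_iff.mp (hA.diag_nonneg (i := a))).1

/-- ★ LOEWNER-MONOTONE DIAGONAL: `A ⪯ B` (i.e. `B − A ⪰ 0`) ⟹ `Re A_{aa} ≤ Re B_{aa}`. [cite: HornJohnson2013, Obs. 7.1.2 §7.1] -/
theorem re_diag_le_of_posSemidef_sub {A B : Matrix ι ι 𝕜} (h : (B - A).PosSemidef) (a : ι) : RCLike.re (A a a) ≤ RCLike.re (B a a) := by
  have h0 := re_diag_nonneg_of_posSemidef h a
  rw [Matrix.sub_apply, map_sub] at h0
  linarith

/-- `A ⪯ β·1` ⟹ `Re A_{aa} ≤ β`. [cite: HornJohnson2013, Obs. 7.1.2 §7.1] -/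
theorem re_diag_le_of_le_smul_one [DecidableEq ι] {A : Matrix ι ι 𝕜} {β : ℝ} (h : ((β : 𝕜) • (1 : Matrix ι ι 𝕜) - A).PosSemidef) (a : ι) :
    RCLike.re (A a a) ≤ β := by
  have h0 := re_diag_le_of_posSemidef_sub h a
  rwa [Matrix.smul_apply, Matrix.one_apply_eq, smul_eq_mul, mul_one, RCLike.ofReal_re] at h0

/-- `β₀·1 ⪯ A ⪯ β₁·1` ⟹ `Re A_{aa} ∈ [β₀, β₁]`. [cite: HornJohnson2013, Obs. 7.1.2 §7.1] -/
theorem re_diag_mem_Icc_of_sandwich [DecidableEq ι] {A : Matrix ι ι 𝕜} {β₀ β₁ : ℝ} (h0 : (A - (β₀ : 𝕜) • (1 : Matrix ι ι 𝕜)).PosSemidef)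
    (h1 : ((β₁ : 𝕜) • (1 : Matrix ι ι 𝕜) - A).PosSemidef) (a : ι) : RCLike.re (A a a) ∈ Set.Icc β₀ β₁ := by
  refine ⟨?_, re_diag_le_of_le_smul_one h1 a⟩
  have h := re_diag_le_of_posSemidef_sub h0 a
  rwa [Matrix.smul_apply, Matrix.one_apply_eq, smul_eq_mul, mul_one, RCLike.ofReal_re] at h

end Diagonal

/-! ## §3 Entries of a positive semidefinite matrix: `‖A_{ab}‖² ≤ A_{aa}A_{bb}` — the diagonal dominates -/

section Entries

/-- ★★ **THE DIAGONAL DOMINATES**: `A ⪰ 0` and `Re A_{aa} ≤ β` for every `a` ⟹ `‖A_{ab}‖ ≤ β` for all `a, b` (`‖A_{ab}‖² ≤ A_{aa}A_{bb} ≤ β²`). [cite: HornJohnson2013, 7.1.P1 §7.1; King1986, (4.35) p.674] -/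
theorem norm_entry_le_of_re_diag_le {A : Matrix ι ι 𝕜} (hA : A.PosSemidef) {β : ℝ} (hβ : ∀ a, RCLike.re (A a a) ≤ β) (a b : ι) : ‖A a b‖ ≤ β := by
  have ha0 := re_diag_nonneg_of_posSemidef hA a
  have hb0 := re_diag_nonneg_of_posSemidef hA b
  have hβ0 : 0 ≤ β := ha0.trans (hβ a)
  have hsq : ‖A a b‖ ^ 2 ≤ β ^ 2 :=
    (norm_apply_sq_le_of_posSemidef hA a b).trans (by rw [sq]; exact mul_le_mul (hβ a) (hβ b) hb0 hβ0)
  exact (pow_le_pow_iff_left₀ (norm_nonneg _) hβ0 two_ne_zero).mp hsq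

/-- ★ THE FORM USED FOR THE FULL PROPAGATOR: `0 ⪯ A ⪯ B` and `Re B_{aa} ≤ β` for every `a` ⟹ `‖A_{ab}‖ ≤ β` for all `a, b` (monotone diagonal, then the diagonal dominates).
[cite: HornJohnson2013, Obs. 7.1.2 and 7.1.P1 §7.1; King1986, (2.13) p.653] -/
theorem norm_entry_le_of_posSemidef_sub_of_re_diag_le {A B : Matrix ι ι 𝕜} (hA : A.PosSemidef) (hAB : (B - A).PosSemidef) {β : ℝ}
    (hβ : ∀ a, RCLike.re (B a a) ≤ β) (a b : ι) : ‖A a b‖ ≤ β :=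
  norm_entry_le_of_re_diag_le hA (fun a' => (re_diag_le_of_posSemidef_sub hAB a').trans (hβ a')) a b

end Entries

end Summit.QuantumFields.YangMills.BalabanUVNodes.N15KingModelRung.Analytic

end
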